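import Literature.NumberTheory.EllipticCurves.KugaSatoLevelTwist
import Literature.NumberTheory.EllipticCurves.KugaSatoVarietyBaseChangeHom
import Literature.NumberTheory.EllipticCurves.KugaSatoVarietyAutomorphisms
import HarnessLib

/-!
# The action of `SL₂(ℤ/N)` on the modular component of a Kuga–Sato variety

Topic: `Literature/NumberTheory/EllipticCurves`. A `KugaSatoVariety K m N` (`KugaSatoVariety.lean`)
records, for each `g ∈ SL₂(ℤ/N)`, a morphism `slY g : Y → Y` of the chosen component `Y ↪ Y(N)_K`
together with (field `sl_extends`) a base change `G : E → E` of the restricted universal curve over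
`slY g` carrying the level structure `φ ∘ g = (P^{g₀₀} Q^{g₁₀}, P^{g₀₁} Q^{g₁₁})` to `φ = (P, Q)`;
that is, `slY g` classifies the pair `(E, φ ∘ g)` (Deligne (3.7): "le groupe `GL₂(ℤ/n)` agit sur
`M_n` par `α ↦ α ∘ g`"; Deninger–Scholl (4.10)). The structure asks only for the EXISTENCE of such
data. This file proves that the data are nevertheless canonical and coherent, as consequences of
the fine-moduli property `FullLevelModularCurve.classify` of `Y(N)_K` and of `Y ↪ Y(N)_K` being a
monomorphism:

* `EllCurveOver.IsBaseChangeVia.comp`, `LevelStructure.IsBaseChangeVia.comp` — **base change of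
  elliptic curves (with level structure) is transitive** (Katz–Mazur (2.1), (3.1)): cartesian
  squares paste, and the compatibilities with identity sections, group laws and `P, Q` compose;
* `KugaSatoVariety.hom_ext_of_isBaseChangeVia` — **the component is itself a fine moduli scheme
  for the pairs it carries**: two `K`-morphisms `T → Y` along both of which a pair `(C, ψ)` is a
  base change of `(E|_Y, φ|_Y)` are equal;
* `KugaSatoVariety.eq_slY` — hence `slY g` is THE `K`-endomorphism of `Y` classifying
  `(E, φ ∘ g)` (with `φ ∘ g = LevelStructure.twist φ hc g` of `KugaSatoLevelTwist.lean`);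
* `KugaSatoVariety.slY_one`, `KugaSatoVariety.slY_mul` — **`g ↦ slY g` is an action**:
  `slY 1 = 𝟙` and `slY (h g) = slY h ≫ slY g` (a right action written diagrammatically, matching
  `(φ ∘ h) ∘ g = φ ∘ (h g)`; Deligne (3.7));
* by-products on the shape of the structure: `W`, `E^m` and `Y` are nonempty and irreducible
  (`KugaSatoVariety.irreducibleSpace_fibrePower`, `irreducibleSpace_Y`: `W` is integral
  (`KugaSatoVariety.isIntegral` of `KugaSatoVarietyAutomorphisms.lean`), `E^m ↪ W`
  is a dense open, and `E^m → Y` is surjective because it has the identity section), so the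
  "connected component" `Y` of the docstring of `KugaSatoVariety` is indeed irreducible.

On the hypothesis `hc : Commute φ.P φ.Q` see `KugaSatoLevelTwist.lean` (the sections of an
elliptic curve commute, Katz–Mazur Thm. 2.1.2, but `EllCurveOver` does not record it). The
analogous statements for `slW` are NOT derivable from the structure: `slW g` extends the fibre
power of SOME base change `G` over `slY g`, and `G` is unique only up to automorphisms of
`(E, φ ∘ g)` over `Y`, whose triviality (the rigidity of pairs `(E, φ)` for `N ≥ 3`, which is
what makes `Y(N)` a fine moduli scheme: Deninger–Scholl §4.1, "the assumption `n ≥ 3` assures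
that there is a universal family") is not part of the structure. No named facts.

## References

* P. Deligne, *Formes modulaires et représentations ℓ-adiques*, Sém. Bourbaki 355 (1969), (3.7).
  [Deligne1971Bourbaki355]
* N. Katz, B. Mazur, *Arithmetic moduli of elliptic curves*, Ann. Math. Stud. 108 (1985), (2.1),
  (3.1), Cor. 4.7.2. [KatzMazur1985]
* C. Deninger, A. J. Scholl, *The Beilinson conjectures*, in *L-functions and Arithmetic*,
  LMS LNS 153 (1991), §4.1, (4.10). [DeningerScholl1991]
-/

universe u

open CategoryTheory Limits AlgebraicGeometry MonoidalCategory CartesianMonoidalCategory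
open scoped MonObj MatrixGroups

noncomputable section

namespace Literature.NumberTheory.EllipticCurves

/-! ### Transitivity of base change -/

namespace EllCurveOver

namespace IsBaseChangeVia

variable {S S' S'' : Scheme.{u}} {C : EllCurveOver S} {C' : EllCurveOver S'} {C'' : EllCurveOver S''}
  {g : S' ⟶ S} {G : C'.E.left ⟶ C.E.left} {g' : S'' ⟶ S'} {G' : C''.E.left ⟶ C'.E.left}

-- `(E ⊗ E).left = pullback E.hom E.hom` by unfolding the chosen finite products of `Over S`
-- (cf. `Mathlib.CategoryTheory.Monoidal.Cartesian.Over`, which uses the same option).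
set_option backward.isDefEq.respectTransparency false in
/-- **Base change of elliptic curves is transitive** (Katz–Mazur (2.1): "the formation of `E/S`
commutes with arbitrary base change"): if `G : E' → E` exhibits `E'/S'` as the base change of
`E/S` along `g` and `G' : E'' → E'` exhibits `E''/S''` as the base change of `E'/S'` along `g'`,
then `G' ≫ G` exhibits `E''/S''` as the base change of `E/S` along `g' ≫ g` — the cartesian
squares paste (`IsPullback.paste_horiz`) and the compatibilities with the identity sections and
the group laws compose. [cite: KatzMazur1985, (2.1)] -/
theorem comp (h : C'.IsBaseChangeVia C g G) (h' : C''.IsBaseChangeVia C' g' G') :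
    C''.IsBaseChangeVia C (g' ≫ g) (G' ≫ G) := by
  obtain ⟨w, hpb, hη, hμ⟩ := h
  obtain ⟨w', hpb', hη', hμ'⟩ := h'
  refine ⟨by rw [Category.assoc, w, reassoc_of% w'], hpb'.paste_horiz hpb, ?_, ?_⟩
  · rw [reassoc_of% hη', hη, Category.assoc]
  · rw [reassoc_of% hμ', hμ, ← Category.assoc]
    congr 1
    apply pullback.hom_ext
    · simp only [Category.assoc, pullback.lift_fst, pullback.lift_fst_assoc]
    · simp only [Category.assoc, pullback.lift_snd, pullback.lift_snd_assoc]

end IsBaseChangeVia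

namespace LevelStructure.IsBaseChangeVia

variable {S S' S'' : Scheme.{u}} {C : EllCurveOver S} {C' : EllCurveOver S'} {C'' : EllCurveOver S''}
  {N : ℕ} {φ : LevelStructure N C} {φ' : LevelStructure N C'} {φ'' : LevelStructure N C''}
  {g : S' ⟶ S} {G : C'.E.left ⟶ C.E.left} {g' : S'' ⟶ S'} {G' : C''.E.left ⟶ C'.E.left}

-- `(𝟙_ (Over S')).left = S'` by unfolding (types of the sections `P`, `Q`).
set_option backward.isDefEq.respectTransparency false in
/-- **Base change of level structures is transitive** (Katz–Mazur (3.1), functoriality of level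
structures in the base; Deligne (3.6), composition of morphisms of pairs `(E, α)`): if `(E', φ')`
is the base change of `(E, φ)` along `(g, G)` and `(E'', φ'')` that of `(E', φ')` along `(g', G')`,
then `(E'', φ'')` is the base change of `(E, φ)` along `(g' ≫ g, G' ≫ G)`.
[cite: KatzMazur1985, (3.1)] -/
theorem comp (h : φ'.IsBaseChangeVia φ g G) (h' : φ''.IsBaseChangeVia φ' g' G') :
    φ''.IsBaseChangeVia φ (g' ≫ g) (G' ≫ G) := by
  refine ⟨h.1.comp h'.1, ?_, ?_⟩
  · rw [← Category.assoc, h'.2.1, Category.assoc, h.2.1, Category.assoc]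
  · rw [← Category.assoc, h'.2.2, Category.assoc, h.2.2, Category.assoc]

end LevelStructure.IsBaseChangeVia

namespace LevelStructure

variable {S : Scheme.{u}} {C : EllCurveOver S} {N : ℕ} (φ : LevelStructure N C)

/-- `φ(1, 0) = P`. [folklore] -/
theorem section_one_zero [NeZero N] : φ.section_ (1, 0) = φ.P := by
  rw [section_, ZMod.val_zero, pow_zero, mul_one, ZMod.val_one_eq_one_mod,
    ← pow_eq_pow_mod _ φ.pow_P, pow_one]

/-- `φ(0, 1) = Q`. [folklore] -/
theorem section_zero_one [NeZero N] : φ.section_ (0, 1) = φ.Q := by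
  rw [section_, ZMod.val_zero, pow_zero, one_mul, ZMod.val_one_eq_one_mod,
    ← pow_eq_pow_mod _ φ.pow_Q, pow_one]

/-- The columns of a product: `(φ ∘ h)(g₀₀, g₁₀) = (φ ∘ (h g))(1, 0)`, i.e. the first section of
`φ ∘ (h g)` is the `(g₀₀, g₁₀)`-section of `φ ∘ h`. [folklore] -/
theorem twist_section_col_zero [NeZero N] (hc : Commute φ.P φ.Q) (h g : SL(2, ZMod N)) :
    (φ.twist hc h).section_ (g.1 0 0, g.1 1 0) = (φ.twist hc (h * g)).P := by
  rw [twist_section_, twist_P, vecAct_apply, Matrix.SpecialLinearGroup.coe_mul, Matrix.mul_apply,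
    Matrix.mul_apply, Fin.sum_univ_two, Fin.sum_univ_two]

/-- The columns of a product: the second section of `φ ∘ (h g)` is the `(g₀₁, g₁₁)`-section of
`φ ∘ h`. [folklore] -/
theorem twist_section_col_one [NeZero N] (hc : Commute φ.P φ.Q) (h g : SL(2, ZMod N)) :
    (φ.twist hc h).section_ (g.1 0 1, g.1 1 1) = (φ.twist hc (h * g)).Q := by
  rw [twist_section_, twist_Q, vecAct_apply, Matrix.SpecialLinearGroup.coe_mul, Matrix.mul_apply,
    Matrix.mul_apply, Fin.sum_univ_two, Fin.sum_univ_two]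

end LevelStructure

end EllCurveOver

/-! ### The component `Y` as a fine moduli scheme, and the action of `SL₂(ℤ/N)` on it -/

namespace KugaSatoVariety

open Literature.AlgebraicGeometry.Motives EllCurveOver

variable {K : Type u} [Field K] {m N : ℕ} (V : KugaSatoVariety K m N)

/-- `Y ↪ Y(N)_K` is a monomorphism of `K`-schemes (an open immersion of schemes is a
monomorphism). [folklore] -/
theorem mono_ιY : Mono V.ιY :=
  haveI : IsOpenImmersion V.ιY.left := V.ιY_isOpenImmersion
  Over.mono_of_mono_left V.ιY

/-- **The component `Y` is a fine moduli scheme for the pairs it carries.** If a pair `(C, ψ)`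
over a `K`-scheme `T` is the base change of the restricted universal pair `(E|_Y, φ|_Y)` along two
`K`-morphisms `f₁, f₂ : T → Y`, then `f₁ = f₂`: composing with the base change
`(E|_Y, φ|_Y) → (E, φ)` over `Y ↪ Y(N)_K` (field `curve_isBaseChange`) makes `f₁ ≫ ιY` and
`f₂ ≫ ιY` classify `(C, ψ)`, so they agree by the fine-moduli property of `Y(N)_K`
(`FullLevelModularCurve.classify`, Deligne (3.6)–(3.7), Katz–Mazur Cor. 4.7.2), and `ιY` is a
monomorphism. [cite: KatzMazur1985, Cor. 4.7.2] -/
theorem hom_ext_of_isBaseChangeVia {T : SchemeOver K} {C : EllCurveOver T.left}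
    (ψ : C.LevelStructure N) {f₁ f₂ : T ⟶ V.Y} {G₁ G₂ : C.E.left ⟶ V.curve.E.left}
    (h₁ : ψ.IsBaseChangeVia V.level f₁.left G₁) (h₂ : ψ.IsBaseChangeVia V.level f₂.left G₂) :
    f₁ = f₂ := by
  obtain ⟨G₀, h₀⟩ := V.curve_isBaseChange
  have key : f₁ ≫ V.ιY = f₂ ≫ V.ιY :=
    (V.moduli.classify T C ψ).unique ⟨G₁ ≫ G₀, h₀.comp h₁⟩ ⟨G₂ ≫ G₀, h₀.comp h₂⟩
  haveI := V.mono_ιY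
  exact (cancel_mono V.ιY).mp key

/-- The base-change data of the field `sl_extends`, phrased with `LevelStructure.twist`: along
`slY g` and some `G : E → E`, the pair `(E, φ ∘ g)` is the base change of `(E, φ)`. [folklore] -/
theorem exists_twist_isBaseChangeVia [NeZero N] (hc : Commute V.level.P V.level.Q)
    (g : SL(2, ZMod N)) :
    ∃ G : V.curve.E.left ⟶ V.curve.E.left,
      (V.level.twist hc g).IsBaseChangeVia V.level (V.slY g).left G := by
  obtain ⟨G, -, hG, hP, hQ, -, -, -⟩ := V.sl_extends g
  exact ⟨G, hG, hP, hQ⟩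

/-- **`slY g` is the classifying morphism of `(E, φ ∘ g)`.** Any `K`-endomorphism `f` of `Y`
along which (and along some `G : E → E`) the pair `(E, φ ∘ g)` is the base change of `(E, φ)`
equals `slY g` (Deligne (3.7): `g` acts on `M_n` by `α ↦ α ∘ g`; here restricted to the
stabiliser `SL₂(ℤ/N)` of the component). [cite: Deligne1971Bourbaki355, (3.7)] -/
theorem eq_slY [NeZero N] (hc : Commute V.level.P V.level.Q) (g : SL(2, ZMod N)) {f : V.Y ⟶ V.Y}
    {G : V.curve.E.left ⟶ V.curve.E.left}
    (h : (V.level.twist hc g).IsBaseChangeVia V.level f.left G) : f = V.slY g := by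
  obtain ⟨G', h'⟩ := V.exists_twist_isBaseChangeVia hc g
  exact V.hom_ext_of_isBaseChangeVia _ h h'

/-- **`slY 1 = 𝟙`**: the identity classifies `(E, φ ∘ 1) = (E, φ)`. (No commutativity hypothesis
is needed: `φ ∘ 1 = (φ(1, 0), φ(0, 1)) = (P, Q)`.) [cite: Deligne1971Bourbaki355, (3.7)] -/
theorem slY_one [NeZero N] : V.slY 1 = 𝟙 V.Y := by
  obtain ⟨G, -, hG, hP, hQ, -, -, -⟩ := V.sl_extends 1
  rw [Matrix.SpecialLinearGroup.coe_one, Matrix.one_apply_eq, Matrix.one_apply_ne (by decide),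
    V.level.section_one_zero] at hP
  rw [Matrix.SpecialLinearGroup.coe_one, Matrix.one_apply_eq, Matrix.one_apply_ne (by decide),
    V.level.section_zero_one] at hQ
  have h₁ : V.level.IsBaseChangeVia V.level (V.slY 1).left G := ⟨hG, hP, hQ⟩
  have h₂ : V.level.IsBaseChangeVia V.level (𝟙 V.Y : V.Y ⟶ V.Y).left (𝟙 _) :=
    LevelStructure.IsBaseChangeVia.refl V.level
  exact V.hom_ext_of_isBaseChangeVia V.level h₁ h₂

-- `(𝟙_ (Over Y)).left = Y` by unfolding (types of the sections).
set_option backward.isDefEq.respectTransparency false in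
/-- **`g ↦ slY g` is an action of `SL₂(ℤ/N)` on `Y`**: `slY (h g) = slY h ≫ slY g`. Along
`slY h ≫ slY g` the pair `(E, φ ∘ (h g))` is the base change of `(E, φ)`: pull `(P, Q)` back along
`slY g` to `φ ∘ g`, then along `slY h` — a base change is a homomorphism on sections
(`LevelStructure.IsBaseChangeVia.section_left_comp`), so the columns `φ(g₀₀, g₁₀), φ(g₀₁, g₁₁)` of
`φ ∘ g` pull back to `(φ ∘ h)(g₀₀, g₁₀), (φ ∘ h)(g₀₁, g₁₁)`, the columns of `φ ∘ (h g)`; conclude by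
`eq_slY` (Deligne (3.7): `α ↦ α ∘ g` is a right action of `GL₂(ℤ/n)` on `M_n`). Requires `P, Q` to
commute. [cite: Deligne1971Bourbaki355, (3.7)] -/
theorem slY_mul [NeZero N] (hc : Commute V.level.P V.level.Q) (h g : SL(2, ZMod N)) :
    V.slY (h * g) = V.slY h ≫ V.slY g := by
  obtain ⟨Gh, hh⟩ := V.exists_twist_isBaseChangeVia hc h
  obtain ⟨Gg, hg⟩ := V.exists_twist_isBaseChangeVia hc g
  refine (V.eq_slY hc (h * g) (f := V.slY h ≫ V.slY g) (G := Gh ≫ Gg) ?_).symm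
  rw [Over.comp_left]
  refine ⟨hg.1.comp hh.1, ?_, ?_⟩
  · rw [← V.level.twist_section_col_zero hc h g, ← Category.assoc,
      hh.section_left_comp (g.1 0 0, g.1 1 0), Category.assoc, ← V.level.twist_P hc g, hg.2.1,
      Category.assoc]
  · rw [← V.level.twist_section_col_one hc h g, ← Category.assoc,
      hh.section_left_comp (g.1 0 1, g.1 1 1), Category.assoc, ← V.level.twist_Q hc g, hg.2.2,
      Category.assoc]

/-- `slY g` is invertible, with inverse `slY g⁻¹`. [folklore] -/
theorem slY_inv_comp [NeZero N] (hc : Commute V.level.P V.level.Q) (g : SL(2, ZMod N)) :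
    V.slY g⁻¹ ≫ V.slY g = 𝟙 V.Y := by
  rw [← V.slY_mul hc, inv_mul_cancel, V.slY_one]

/-- `slY g` is invertible, with inverse `slY g⁻¹`. [folklore] -/
theorem slY_comp_inv [NeZero N] (hc : Commute V.level.P V.level.Q) (g : SL(2, ZMod N)) :
    V.slY g ≫ V.slY g⁻¹ = 𝟙 V.Y := by
  rw [← V.slY_mul hc, mul_inv_cancel, V.slY_one]

/-- Each `slY g` is an isomorphism of `K`-schemes. [folklore] -/
theorem isIso_slY [NeZero N] (hc : Commute V.level.P V.level.Q) (g : SL(2, ZMod N)) :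
    IsIso (V.slY g) :=
  ⟨V.slY g⁻¹, V.slY_comp_inv hc g, V.slY_inv_comp hc g⟩

/-! ### `W`, `E^m` and `Y` are irreducible -/

/-- The fibre power `E^m` is nonempty: it is dense in the nonempty scheme `W`. [folklore] -/
theorem nonempty_fibrePower : Nonempty (KugaSato.fibrePower V.curve.E m).left := by
  haveI : IsIntegral V.W.left := V.isIntegral
  haveI : IsDominant V.jW := V.jW_isDominant
  exact V.jW.denseRange.nonempty

/-- **The fibre power `E^m` is irreducible**: it is a nonempty open subscheme of the irreducible
scheme `W`. [folklore] -/
theorem irreducibleSpace_fibrePower : IrreducibleSpace (KugaSato.fibrePower V.curve.E m).left := by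
  haveI : IsIntegral V.W.left := V.isIntegral
  haveI : IsOpenImmersion V.jW := V.jW_isOpenImmersion
  haveI := V.nonempty_fibrePower
  exact V.jW.isOpenEmbedding.irreducibleSpace

-- `(𝟙_ (Over Y)).left = Y`, `(𝟙_ (Over Y)).hom = 𝟙 Y` by unfolding (the identity section).
set_option backward.isDefEq.respectTransparency false in
/-- `E^m → Y` is surjective: it has the section `(0, …, 0)`. [folklore] -/
theorem surjective_fibrePower_hom :
    Function.Surjective (KugaSato.fibrePower V.curve.E m).hom := by
  intro y
  let s : 𝟙_ (Over V.Y.left) ⟶ KugaSato.fibrePower V.curve.E m :=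
    KugaSato.lift V.curve.E m fun _ => η[V.curve.E]
  refine ⟨s.left y, ?_⟩
  rw [← Scheme.Hom.comp_apply, Over.w s]
  rfl

/-- **The component `Y` is irreducible** (hence connected): it is the image of the irreducible
scheme `E^m` under `E^m → Y`. (The docstring of `KugaSatoVariety` calls `Y` "a connected component:
… it is connected, indeed geometrically irreducible, because `W` is"; this is the irreducibility
half.) [folklore] -/
theorem irreducibleSpace_Y : IrreducibleSpace V.Y.left := by
  haveI := V.irreducibleSpace_fibrePower
  exact V.surjective_fibrePower_hom.irreducibleSpace (KugaSato.fibrePower V.curve.E m).hom.continuous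

/-- `Y` is nonempty. [folklore] -/
theorem nonempty_Y : Nonempty V.Y.left :=
  haveI := V.irreducibleSpace_Y
  inferInstance

end KugaSatoVariety

end Literature.NumberTheory.EllipticCurves

end
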